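import Summits.CriticalPhenomena.CardyFormulaZ2.Theorems.EdgeCoherence.Negative.CornerObservableRigidity

/-!
# `EdgeCoherence` (route `CardyComplexCone`, stmt-CriticalPhenomena-11385) is FALSE without the
# interior restriction and without compactness of `K`

Negative lemmas for the crux `EdgeCoherence` (cdisprove unit, refuter
`refuter-cdisprove-stmt-CriticalPhenomena-11385-0`), "any proof must use H" form:

* `edgeCoherence_false_without_interior : ¬ ∃ u, (u ≠ 0 on a class) ∧ EdgeCoherenceWithoutInterior u`
  — the crux with the hypothesis `K ⊆ D.carrier` dropped;
* `edgeCoherence_false_without_compact : ¬ ∃ u, … ∧ EdgeCoherenceWithoutCompact u` — `IsCompact K`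
  dropped (then `K = D.carrier` is allowed, which contains every site of the discrete domain);
* (file `FalseWithoutMesh.lean`) `edgeCoherence_false_without_mesh` — `(Λ δ).δ = δ` dropped.

Mechanism (file `CornerObservableRigidity.lean`): at the discrete marked point where the exploration
path of an admissible family starts, the first dart is deterministic and the faces of two corner
classes leave the domain, so the class vector `(E₀,E₁,E₂,E₃)` of the corner observable is RIGID:
`(·,0,0,1)` for `UnitDiscDiscretisation.discData` (start class `−e₁`), `(0,1,·,0)` for the
arc-swapped twin (start class `−e₀`), at every mesh.  `u_apply_eq_zero_of_rigid` (pure logic from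
the shape of the crux's conclusion) then kills every class of a `u` coherent with both.  MORAL for
provers of the crux: coherence is an INTERIOR phenomenon — the universal class vector cannot be read
off, or propagated from, the boundary layer, and the statement genuinely needs the lattice to refine.
Each strengthening implies the crux (`edgeCoherence_of_without…`), so these are load-bearing
certificates, not evidence against `EdgeCoherence` itself.
-/

noncomputable section

open MeasureTheory Filter Topology
open Literature.Probability.LatticeModels Literature.Probability.RandomPlanarGeometry
open Literature.Probability.Percolation

namespace Summit.CriticalPhenomena.CardyFormulaZ2.Theorems.EdgeCoherence.Negative

open Summit.CriticalPhenomena.CardyFormulaZ2.Theses.CardyComplexCone (EdgeCoherence)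

/-! ## §2 Rigid boundary data kill classes (the assembly lemma) -/

/-- **Rigidity kills classes.**  Let `u` be coherent on the family `Λ` over `K`.  If along mesh
sizes `δₙ → 0⁺` there are vertices `vₙ` with `δₙ vₙ ∈ K`, a corner `(vₙ, vₙ + a)` whose observable
has modulus `≥ m > 0` and a corner `(vₙ, vₙ + b)` whose observable VANISHES, then `u b = 0`.
(Pure logic from the shape of the conclusion; used in §3 with the deterministic first darts of
the exploration path at the discrete marked point.) [folklore] -/
theorem u_apply_eq_zero_of_rigid {u : Site 2 → ℂ} {Λ : ℝ → DiscreteDobrushin} {K : Set ℂ}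
    (hcoh : CoherentOn u Λ K) {a b : Site 2} (s : ℕ → ℝ) (hs : Tendsto s atTop (𝓝[>] (0:ℝ)))
    {m : ℝ} (hm : 0 < m)
    (h : ∀ n, ∃ v : Site 2, IsCorner v (v + a) ∧ IsCorner v (v + b) ∧ meshPoint (s n) v ∈ K ∧
      m ≤ ‖cornerObs Λ (s n) v (v + a)‖ ∧ cornerObs Λ (s n) v (v + b) = 0) :
    u b = 0 := by
  by_contra hb
  have hub : 0 < ‖u b‖ := norm_pos_iff.2 hb
  set ε : ℝ := m * ‖u b‖ / 2 with hε
  have hεpos : 0 < ε := by positivity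
  have h1 : ∀ᶠ n in atTop, ∀ v f f' : Site 2, IsCorner v f → IsCorner v f' →
      meshPoint (s n) v ∈ K →
        ‖u (f' - v) * cornerObs Λ (s n) v f - u (f - v) * cornerObs Λ (s n) v f'‖ ≤
          ε * (s n) ^ ((1:ℝ) / 3) := hs.eventually (hcoh ε hεpos)
  have h2 : ∀ᶠ n in atTop, s n ∈ Set.Ioo (0:ℝ) 1 := by
    have : Set.Ioo (0:ℝ) 1 ∈ 𝓝[>] (0:ℝ) := Ioo_mem_nhdsGT one_pos
    exact hs.eventually this
  obtain ⟨n, hn1, hn2⟩ := (h1.and h2).exists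
  obtain ⟨v, hva, hvb, hvK, hma, hzero⟩ := h n
  have key := hn1 v (v + a) (v + b) hva hvb hvK
  rw [hzero, mul_zero, sub_zero, add_sub_cancel_left, norm_mul] at key
  have hpow : (s n) ^ ((1:ℝ) / 3) ≤ 1 :=
    Real.rpow_le_one hn2.1.le hn2.2.le (by norm_num)
  have : ‖u b‖ * m ≤ ε := by
    calc ‖u b‖ * m ≤ ‖u b‖ * ‖cornerObs Λ (s n) v (v + a)‖ :=
          mul_le_mul_of_nonneg_left hma hub.le
      _ ≤ ε * (s n) ^ ((1:ℝ) / 3) := key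
      _ ≤ ε * 1 := mul_le_mul_of_nonneg_left hpow hεpos.le
      _ = ε := mul_one ε
  rw [hε] at this
  nlinarith

/-! ## §3 The boundary strengthenings (false) -/

/-- `EdgeCoherence` with the hypothesis `K ⊆ D.carrier` DROPPED (coherence on every compact
`K ⊆ ℂ`, i.e. up to and including the boundary layer), as a predicate on the class vector `u`
(the dropped-hypothesis statement is `∃ u, (∃ o, IsCorner 0 o ∧ u o ≠ 0) ∧ EdgeCoherenceWithoutInterior u`). -/
def EdgeCoherenceWithoutInterior (u : Site 2 → ℂ) : Prop :=
  ∀ (D : DobrushinDomain) (Λ : ℝ → DiscreteDobrushin), (∀ δ, (Λ δ).Ω = D.carrier) →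
    (∀ δ, (Λ δ).δ = δ) → (∀ᶠ δ in 𝓝[>] (0:ℝ), (Λ δ).IsZdAdmissible) →
      ∀ K : Set ℂ, IsCompact K → CoherentOn u Λ K

/-- `EdgeCoherence` with the hypothesis `IsCompact K` DROPPED (then `K = D.carrier` is allowed,
which contains every mesh point of the discrete domain, boundary sites included), as a predicate on `u`. -/
def EdgeCoherenceWithoutCompact (u : Site 2 → ℂ) : Prop :=
  ∀ (D : DobrushinDomain) (Λ : ℝ → DiscreteDobrushin), (∀ δ, (Λ δ).Ω = D.carrier) →
    (∀ δ, (Λ δ).δ = δ) → (∀ᶠ δ in 𝓝[>] (0:ℝ), (Λ δ).IsZdAdmissible) →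
      ∀ K : Set ℂ, K ⊆ D.carrier → CoherentOn u Λ K

/-- Both strengthenings imply the crux (they quantify over more sets `K`): their refutation reads
"the interior restriction is load-bearing", not as evidence against the crux. [folklore] -/
theorem edgeCoherence_of_withoutInterior {u : Site 2 → ℂ} (hu : ∃ o : Site 2, IsCorner 0 o ∧ u o ≠ 0)
    (h : EdgeCoherenceWithoutInterior u) : EdgeCoherence := by
  rw [edgeCoherence_iff]
  exact ⟨u, hu, fun D Λ h1 h2 h3 K hK _ => h D Λ h1 h2 h3 K hK⟩

/-- `EdgeCoherenceWithoutCompact` implies the crux. [folklore] -/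
theorem edgeCoherence_of_withoutCompact {u : Site 2 → ℂ} (hu : ∃ o : Site 2, IsCorner 0 o ∧ u o ≠ 0)
    (h : EdgeCoherenceWithoutCompact u) : EdgeCoherence := by
  rw [edgeCoherence_iff]
  exact ⟨u, hu, fun D Λ h1 h2 h3 K _ hK => h D Λ h1 h2 h3 K hK⟩

/-! ## §3c Consequence: up to the boundary, a coherent `u` dies on two classes -/

/-- Face form of `u_apply_eq_zero_of_rigid`. [folklore] -/
theorem u_eq_zero_of_rigid_faceAt {u : Site 2 → ℂ} {Λ : ℝ → DiscreteDobrushin} {K : Set ℂ}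
    (hcoh : CoherentOn u Λ K) (ka kb : Fin 4) (s : ℕ → ℝ) (hs : Tendsto s atTop (𝓝[>] (0:ℝ)))
    {m : ℝ} (hm : 0 < m)
    (h : ∀ n, ∃ v : Site 2, meshPoint (s n) v ∈ K ∧ m ≤ ‖cornerObs Λ (s n) v (faceAt v ka)‖ ∧
      cornerObs Λ (s n) v (faceAt v kb) = 0) :
    u (-cornerOff kb) = 0 := by
  refine u_apply_eq_zero_of_rigid hcoh (a := -cornerOff ka) s hs hm fun n => ?_
  obtain ⟨v, hK, hma, hzero⟩ := h n
  have ea : v + -cornerOff ka = faceAt v ka := by simp [faceAt, sub_eq_add_neg]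
  have eb : v + -cornerOff kb = faceAt v kb := by simp [faceAt, sub_eq_add_neg]
  refine ⟨v, ?_, ?_, hK, ?_, ?_⟩
  · rw [ea]; exact isCorner_faceAt v ka
  · rw [eb]; exact isCorner_faceAt v kb
  · rwa [ea]
  · rwa [eb]

/-- The mesh sequence `δₙ = 1/(n+c) → 0⁺` for `c > 0`. [folklore] -/
theorem tendsto_one_div_nat_add {c : ℝ} (hc : 0 < c) :
    Tendsto (fun n : ℕ => (1:ℝ) / ((n:ℝ) + c)) atTop (𝓝[>] (0:ℝ)) := by
  rw [tendsto_nhdsWithin_iff]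
  refine ⟨?_, Eventually.of_forall fun n => Set.mem_Ioi.2 (by positivity)⟩
  have h : Tendsto (fun n : ℕ => ((n:ℝ) + c)⁻¹) atTop (𝓝 0) :=
    tendsto_inv_atTop_zero.comp
      (tendsto_atTop_add_const_right atTop c tendsto_natCast_atTop_atTop)
  simpa [one_div] using h

/-- **Up to the boundary, coherence kills the classes `−e₀` and `−e₀−e₁`.**  If `u` is coherent on
the certified disc family over a set containing the open disc (e.g. `K = closedBall 0 1` for
`EdgeCoherenceWithoutInterior`, `K = ball 0 1 = D.carrier` for `EdgeCoherenceWithoutCompact`), then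
`u (−e₀) = u (−e₀−e₁) = 0`: at the discrete marked point the class vector is `(·, 0, 0, 1)`. [folklore] -/
theorem u_classes_eq_zero_of_coherentOn_disc {u : Site 2 → ℂ} {K : Set ℂ}
    (hK : Metric.ball (0:ℂ) 1 ⊆ K) (hcoh : CoherentOn u UnitDiscDiscretisation.discData K) :
    u (-cornerOff 1) = 0 ∧ u (-cornerOff 2) = 0 := by
  have hs := tendsto_one_div_nat_add (show (0:ℝ) < 3 by norm_num)
  have hpos : ∀ n : ℕ, (0:ℝ) < 1 / ((n:ℝ) + 3) := fun n => by positivity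
  have hlt : ∀ n : ℕ, (1:ℝ) / ((n:ℝ) + 3) < 1 / 2 := fun n => by
    exact one_div_lt_one_div_of_lt (by norm_num) (by linarith [n.cast_nonneg (α := ℝ)])
  have key : ∀ kb : Fin 4, (∀ n : ℕ, cornerObs UnitDiscDiscretisation.discData (1 / ((n:ℝ) + 3))
      ![-(UnitDiscDiscretisation.abCol (1 / ((n:ℝ) + 3)) : ℤ), 0]
      (faceAt ![-(UnitDiscDiscretisation.abCol (1 / ((n:ℝ) + 3)) : ℤ), 0] kb) = 0) →
      u (-cornerOff kb) = 0 := by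
    intro kb hz
    refine u_eq_zero_of_rigid_faceAt hcoh 3 kb _ hs one_pos fun n => ⟨_, hK ?_, ?_, hz n⟩
    · simpa using norm_meshPoint_vA_lt_one (hpos n) (hlt n)
    · rw [cornerObs_discData_start (hpos n) (hlt n)]; simp
  exact ⟨key 1 fun n => cornerObs_discData_vA_one (hpos n) (hlt n),
    key 2 fun n => cornerObs_discData_vA_two (hpos n) (hlt n)⟩

/-- **Up to the boundary, coherence on the swapped family kills the classes `0` and `−e₁`.** [folklore] -/
theorem u_classes_eq_zero_of_coherentOn_discSwap {u : Site 2 → ℂ} {K : Set ℂ}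
    (hK : Metric.ball (0:ℂ) 1 ⊆ K) (hcoh : CoherentOn u discDataSwap K) :
    u (-cornerOff 0) = 0 ∧ u (-cornerOff 3) = 0 := by
  have hs := tendsto_one_div_nat_add (show (0:ℝ) < 3 by norm_num)
  have hpos : ∀ n : ℕ, (0:ℝ) < 1 / ((n:ℝ) + 3) := fun n => by positivity
  have hlt : ∀ n : ℕ, (1:ℝ) / ((n:ℝ) + 3) < 1 / 2 := fun n =>
    one_div_lt_one_div_of_lt (by norm_num) (by linarith [n.cast_nonneg (α := ℝ)])
  have key : ∀ kb : Fin 4, (∀ n : ℕ, cornerObs discDataSwap (1 / ((n:ℝ) + 3))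
      ![(UnitDiscDiscretisation.abCol (1 / ((n:ℝ) + 3)) : ℤ), 0]
      (faceAt ![(UnitDiscDiscretisation.abCol (1 / ((n:ℝ) + 3)) : ℤ), 0] kb) = 0) →
      u (-cornerOff kb) = 0 := by
    intro kb hz
    refine u_eq_zero_of_rigid_faceAt hcoh 1 kb _ hs one_pos fun n => ⟨_, hK ?_, ?_, hz n⟩
    · simpa using norm_meshPoint_xR0_lt_one (hpos n) (hlt n)
    · rw [cornerObs_discDataSwap_start (hpos n) (hlt n)]; simp
  exact ⟨key 0 fun n => cornerObs_discDataSwap_zero (hpos n) (hlt n),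
    key 3 fun n => cornerObs_discDataSwap_three (hpos n) (hlt n)⟩

/-- Corner offsets are the four `-cornerOff k`. [folklore] -/
theorem exists_eq_neg_cornerOff_of_isCorner {o : Site 2} (ho : IsCorner 0 o) :
    ∃ k : Fin 4, o = -cornerOff k := by
  obtain ⟨k, hk⟩ := exists_faceAt_of_isCorner ho
  exact ⟨k, by rw [hk]; simp [faceAt]⟩

/-- The two certified families are discretisation families of the unit disc in the crux's sense. [folklore] -/
theorem discData_isFamily :
    (∀ δ, (UnitDiscDiscretisation.discData δ).Ω = DobrushinDomain.unitDisc.carrier) ∧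
    (∀ δ, (UnitDiscDiscretisation.discData δ).δ = δ) ∧
    (∀ᶠ δ in 𝓝[>] (0:ℝ), (UnitDiscDiscretisation.discData δ).IsZdAdmissible) := by
  refine ⟨fun _ => rfl, fun _ => rfl, ?_⟩
  filter_upwards [Ioo_mem_nhdsGT (show (0:ℝ) < 1 / 2 by norm_num)] with δ hδ
  exact UnitDiscDiscretisation.isZdAdmissible_discData hδ.1 hδ.2

/-- The swapped family is a discretisation family of the unit disc. [folklore] -/
theorem discDataSwap_isFamily :
    (∀ δ, (discDataSwap δ).Ω = DobrushinDomain.unitDisc.carrier) ∧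
    (∀ δ, (discDataSwap δ).δ = δ) ∧
    (∀ᶠ δ in 𝓝[>] (0:ℝ), (discDataSwap δ).IsZdAdmissible) := by
  refine ⟨fun _ => rfl, fun _ => rfl, ?_⟩
  filter_upwards [Ioo_mem_nhdsGT (show (0:ℝ) < 1 / 2 by norm_num)] with δ hδ
  exact isZdAdmissible_discDataSwap hδ.1 hδ.2

/-- **No `u` is coherent up to the boundary on both certified disc families.** [folklore] -/
theorem not_coherentOn_both {u : Site 2 → ℂ} (hu : ∃ o : Site 2, IsCorner 0 o ∧ u o ≠ 0)
    {K : Set ℂ} (hK : Metric.ball (0:ℂ) 1 ⊆ K)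
    (h₁ : CoherentOn u UnitDiscDiscretisation.discData K) (h₂ : CoherentOn u discDataSwap K) :
    False := by
  obtain ⟨o, ho, huo⟩ := hu
  obtain ⟨k, rfl⟩ := exists_eq_neg_cornerOff_of_isCorner ho
  obtain ⟨h1, h2⟩ := u_classes_eq_zero_of_coherentOn_disc hK h₁
  obtain ⟨h0, h3⟩ := u_classes_eq_zero_of_coherentOn_discSwap hK h₂
  fin_cases k
  · exact huo h0
  · exact huo h1
  · exact huo h2
  · exact huo h3

/-- **THEOREM (load-bearing hypothesis `K ⊆ D.carrier`).**  `EdgeCoherence` with the interior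
restriction dropped is FALSE: on the unit disc with the certified tilted-arc discretisations,
at the discrete marked point where the exploration starts the class vector of the corner
observable is `(E₀,E₁,E₂,E₃) = (·, 0, 0, 1)` for the family `discData` (start class `−e₁`) and
`(0, 1, ·, 0)` for the arc-swapped family (start class `−e₀`), at every mesh `0 < δ < 1/2`
(deterministic first dart; faces leaving the disc).  A universal `u` coherent with both within
`o(δ^{1/3})` must vanish on all four classes.  Any proof of the crux must therefore use the
interior restriction: coherence is false in the boundary layer, uniformly in `δ`. [folklore] -/
theorem edgeCoherence_false_without_interior :
    ¬ ∃ u : Site 2 → ℂ, (∃ o : Site 2, IsCorner 0 o ∧ u o ≠ 0) ∧ EdgeCoherenceWithoutInterior u := by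
  rintro ⟨u, hu, h⟩
  obtain ⟨a1, a2, a3⟩ := discData_isFamily
  obtain ⟨b1, b2, b3⟩ := discDataSwap_isFamily
  exact not_coherentOn_both hu Metric.ball_subset_closedBall
    (h _ _ a1 a2 a3 _ (isCompact_closedBall 0 1)) (h _ _ b1 b2 b3 _ (isCompact_closedBall 0 1))

/-- **THEOREM (load-bearing hypothesis `IsCompact K`).**  `EdgeCoherence` with compactness of `K`
dropped is FALSE (take `K = D.carrier`, which contains every site of the discrete domain). [folklore] -/
theorem edgeCoherence_false_without_compact :
    ¬ ∃ u : Site 2 → ℂ, (∃ o : Site 2, IsCorner 0 o ∧ u o ≠ 0) ∧ EdgeCoherenceWithoutCompact u := by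
  rintro ⟨u, hu, h⟩
  obtain ⟨a1, a2, a3⟩ := discData_isFamily
  obtain ⟨b1, b2, b3⟩ := discDataSwap_isFamily
  exact not_coherentOn_both hu subset_rfl (h _ _ a1 a2 a3 _ subset_rfl) (h _ _ b1 b2 b3 _ subset_rfl)

end Summit.CriticalPhenomena.CardyFormulaZ2.Theorems.EdgeCoherence.Negative

end
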